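import Summits.CriticalPhenomena.PercolationContinuityZ3.Theorems.PercNearOneGluingNoHeavyQuantLawDecAtomZero
import HarnessLib

/-!
# QUANT lane R8, T-DEC: law-level DEC(j′) criteria, part E — the SINGLE-LOW-ATOM DICHOTOMY: a top-affordable law whose only low
# atom below the layer is `0` is DEC(j′) (criterion E or the empty-atom criterion always applies)

builds on p205010 (kernel theorem, internal audit signed; external expert review pending)

Support file (`--supports stmt-CriticalPhenomena-4575`), QUANT lane seat prim-quant-census-2 (gen 53), rung R8 of
`run/shared/lean/prim/quant/LADDER.md`.  Memo `run/shared/lean/prim/quant/prim-quant-census-2-g53/DEC-CLOSURE-G53.md` §4.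
Theorems only (no definitions), standard axioms.

THE OBSERVATION (census-2 g52 DEC-CRITERIA-G52 §5.3, made a lemma here).  For a law `μ` on `{0..M}` with mean `T`, floor `0 < x < 1`
and layer `j′ < M`, criterion E (`LawDec.decAt_of_giantsAbsorbLows`: `x·P(low) ≤ (1−x)·P(giant)`) and the empty-atom criterion
(`LawDec.decAt_of_atomZero`: `(1−x)·P(giant) ≤ x·μ 0`) are COMPLEMENTARY as soon as the only low atom (`2h < T`, `h ≤ j′`,
`μ h > 0`) is `h = 0`: then `P(low) = μ 0` and one of the two inequalities holds.  Hence: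

* **`LawDec.decAt_of_lowsOnlyZero`** — law `μ ≥ 0` on `{0..M}` (mass 1, mean `T`), `0 < x < 1`, `j′ < M`, every charged atom
  affordable (`x·h ≤ T`), charged atoms `≤ j′` bounded by `h*` with `x·h* ≤ T`, and NO charged atom `h` with `0 < h ≤ j′` and
  `2h < T`.  Then `Quant.LawDec.DECAt x j′ M μ`.
Instances (memo §4): (i) heavy blob systems whose smallest blob is self-sufficient by mean (`2·a_min ≥ T = Σ aᵢgᵢ`): BLOB-DEC at
EVERY window layer, for ANY number of blobs; (ii) a gated law `(1−q)δ₀ + q·μ′` with `q·T′ < 2` (no positive atom below half the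
mean); (iii) every law at the layers where all positive atoms `≤ j′` are `≥ T/2`.  No rate / class statement of the lane changes.

[this work]; DEC rules ARCH-TREES-G49 §2.2 / DEC-TAMP-G50 §3.1 (this lane).  The gluing rows served
[cite: KozmaNitzan2024, Conjecture 3 (p. 15)]; product measure [cite: Grimmett1999, §1.3 p. 10].
-/

noncomputable section

namespace Summit.CriticalPhenomena.PercolationContinuityZ3.Theorems

namespace Quant

open Finset

namespace LawDec

/-- **THE SINGLE-LOW-ATOM DICHOTOMY.**  If the only charged low atom below the layer is `0`, then DEC(j′): either the giants
absorb the atom `0` (criterion E) or the atom `0` pays for the giants (empty-atom criterion).  See the file header. [this work] -/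
theorem decAt_of_lowsOnlyZero (x : ℝ) (j' M hstar : ℕ) (μ : ℕ → ℝ) (hjM : j' < M)
    (hμ0 : ∀ h, 0 ≤ μ h) (hμM : ∀ h, M < h → μ h = 0) (hμ1 : ∑ h ∈ Finset.range (M + 1), μ h = 1)
    (hx0 : 0 < x) (hx1 : x < 1)
    (htop : ∀ h, 0 < μ h → x * (h : ℝ) ≤ ∑ k ∈ Finset.range (M + 1), (k : ℝ) * μ k)
    (hh : ∀ h, h ≤ j' → 0 < μ h → h ≤ hstar) (hhstar : x * (hstar : ℝ) ≤ ∑ k ∈ Finset.range (M + 1), (k : ℝ) * μ k)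
    (hlow : ∀ h, 0 < h → h ≤ j' → 0 < μ h → (∑ k ∈ Finset.range (M + 1), (k : ℝ) * μ k) ≤ 2 * (h : ℝ)) :
    DECAt x j' M μ := by
  set T : ℝ := ∑ k ∈ Finset.range (M + 1), (k : ℝ) * μ k with hT
  -- the low mass below the layer is carried by the atom `0` alone
  have hlowle : ∑ h ∈ Finset.range (j' + 1), (if 2 * (h : ℝ) < T then μ h else 0) ≤ μ 0 := by
    have hterm : ∀ h ∈ Finset.range (j' + 1), (if 2 * (h : ℝ) < T then μ h else 0) ≤ if h = 0 then μ 0 else 0 := by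
      intro h hmem
      by_cases h0 : h = 0
      · subst h0; rw [if_pos rfl]; split_ifs <;> [exact le_rfl; exact hμ0 0]
      · rw [if_neg h0]
        split_ifs with hlt
        · rcases (hμ0 h).eq_or_lt with hz | hpos
          · exact le_of_eq hz.symm
          · exfalso
            have := hlow h (Nat.pos_of_ne_zero h0) (Nat.lt_succ_iff.1 (Finset.mem_range.1 hmem)) hpos
            linarith
        · exact le_rfl
    refine (Finset.sum_le_sum hterm).trans ?_
    rw [Finset.sum_ite_eq' (Finset.range (j' + 1)) 0 (fun _ => μ 0), if_pos (Finset.mem_range.2 (Nat.succ_pos j'))]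
  by_cases hE : x * ∑ h ∈ Finset.range (j' + 1), (if 2 * (h : ℝ) < T then μ h else 0)
      ≤ (1 - x) * ∑ h ∈ Finset.Ico (j' + 1) (M + 1), μ h
  · exact decAt_of_giantsAbsorbLows x j' M μ hjM hμ0 hμM hμ1 hx0 hE
  · refine decAt_of_atomZero x j' M hstar μ hjM hμ0 hμM hμ1 hx0 hx1 htop hh hhstar ?_
    have h1 := mul_le_mul_of_nonneg_left hlowle hx0.le
    linarith [not_le.1 hE]

end LawDec

end Quant

end Summit.CriticalPhenomena.PercolationContinuityZ3.Theorems
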